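import Summits.ResolutionOfSingularities.ResolutionOfSingularities.Theorems.WildDescent11
import HarnessLib

/-!
# WildDescent (12/13) — β-descent in a linear frame; §8 Chain/Descent: L1 `phi_moves_io`/`psi_moves_io`, L6/L7 `regime`, L7 `beta_step`, `wallChain_false`

Verbatim slice of the farm-checked monolith `WildDescent.lean` of cell `decomp-res`, seat `decomp-res-lens-5`, g36
(sha256 4ec0fa6f4f9efba7…); one namespace `Summit.ResolutionOfSingularities.ResolutionOfSingularities.Theorems.WildDescent` across the
slices, imports chained (laws L1–L7 and the mechanism: module docstring of slice 1; main theorems: slice 13/13).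
-/

open MvPolynomial Finset
open scoped BigOperators
open Literature.AlgebraicGeometry.Resolution
open Literature.AlgebraicGeometry.Resolution.Hauser2010
open Literature.AlgebraicGeometry.Resolution.PointBlowup
open Literature.AlgebraicGeometry.Resolution.HauserPerlega2024

namespace Summit.ResolutionOfSingularities.ResolutionOfSingularities.Theorems.WildDescent

section Chain

variable {K : Type} [Field K]

variable {s : ℕ} {G : ℕ → MvPolynomial (Fin 3) K} {j : ℕ → Fin 3} {b : ℕ → Fin 3 → K} {k l f : ℕ → Fin 3} {c : ℕ → K}
  {ℓ : ℕ → MvPolynomial (Fin 3) K}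

section Descent

variable (hs : s ≠ 0) (hkl : ∀ n, k n ≠ l n) (hfk : ∀ n, f n ≠ k n) (hfl : ∀ n, f n ≠ l n)
  (hrec : ∀ n, G (n + 1) = PointBlowup.translate (b n) (chartTransform s (j n) (G n)))
  (hordG : ∀ n, ordZero (G n) = s) (hc : ∀ n, c n ≠ 0) (hℓ : ∀ n, (ℓ n).IsHomogeneous 1)
  (hin : ∀ n, homogeneousComponent s (G n) = C (c n) * ℓ n ^ s)
  (htr : ∀ n, coeff (Finsupp.single (f n) 1) (ℓ n) ≠ 0) (hiso : ∀ n, NearCut.IsolatedMult s (G n))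
  (hmove : ∀ n, j n = l n ∨ j n = f n) (hb : ∀ n i, i ≠ f (n + 1) → b n i = 0)
  (hwalls : ∀ n, (k (n + 1) = k n ∧ l (n + 1) = j n) ∨ (k (n + 1) = j n ∧ l (n + 1) = k n))
  (hskew : ∀ (i : Fin 3) (M : ℕ), ∃ n, M ≤ n ∧ (j n = i ∨ b n i ≠ 0))

include hkl hfk hfl hmove hb hwalls hskew in
/-- **SKEWNESS ⇒ both move types recur:** the wall in slot 2 is lost infinitely often (`Φ`-moves) … [new] -/
theorem phi_moves_io (M : ℕ) : ∃ n, M ≤ n ∧ (slots (k 0) (l 0) l j n).2 = l n := by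
  by_contra hno
  simp only [not_exists, not_and] at hno
  -- then every move from `M` on is a `Ψ`-move and the letter in slot 2 is frozen and never touched
  have hΨ : ∀ n, M ≤ n → (slots (k 0) (l 0) l j n).1 = l n ∧ (slots (k 0) (l 0) l j n).2 = k n := by
    intro n hn
    rcases slots_spec hkl hwalls (j := j) n with ⟨hu, hv⟩ | ⟨hu, hv⟩
    · exact absurd hv (hno n hn)
    · exact ⟨hu, hv⟩
  have hconst : ∀ n, M ≤ n → (slots (k 0) (l 0) l j n).2 = (slots (k 0) (l 0) l j M).2 := by
    intro n hn
    induction n, hn using Nat.le_induction with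
    | base => rfl
    | succ n hn ih => rw [slots_succ, if_pos (hΨ n hn).1]; exact ih
  obtain ⟨n, hn, htouch⟩ := hskew (slots (k 0) (l 0) l j M).2 M
  rw [← hconst n hn, (hΨ n hn).2] at htouch
  rcases htouch with h | h
  · rcases hmove n with hj | hj
    · exact hkl n (h ▸ hj)
    · exact hfk n (h ▸ hj).symm
  · refine h (hb n (k n) ?_)
    rcases hwalls n with ⟨hk', _⟩ | ⟨_, hl'⟩
    · exact hk' ▸ (hfk (n + 1)).symm
    · exact hl' ▸ (hfl (n + 1)).symm

include hkl hfk hfl hmove hb hwalls hskew in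
/-- … and so is the wall in slot 1 (`Ψ`-moves). [new] -/
theorem psi_moves_io (M : ℕ) : ∃ n, M ≤ n ∧ (slots (k 0) (l 0) l j n).1 = l n := by
  by_contra hno
  simp only [not_exists, not_and] at hno
  have hΦ : ∀ n, M ≤ n → (slots (k 0) (l 0) l j n).1 = k n ∧ (slots (k 0) (l 0) l j n).2 = l n := by
    intro n hn
    rcases slots_spec hkl hwalls (j := j) n with ⟨hu, hv⟩ | ⟨hu, hv⟩
    · exact ⟨hu, hv⟩
    · exact absurd hu (hno n hn)
  have hconst : ∀ n, M ≤ n → (slots (k 0) (l 0) l j n).1 = (slots (k 0) (l 0) l j M).1 := by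
    intro n hn
    induction n, hn using Nat.le_induction with
    | base => rfl
    | succ n hn ih =>
      rw [slots_succ, if_neg (by rw [(hΦ n hn).1]; exact hkl n)]; exact ih
  obtain ⟨n, hn, htouch⟩ := hskew (slots (k 0) (l 0) l j M).1 M
  rw [← hconst n hn, (hΦ n hn).1] at htouch
  rcases htouch with h | h
  · rcases hmove n with hj | hj
    · exact hkl n (h ▸ hj)
    · exact hfk n (h ▸ hj).symm
  · refine h (hb n (k n) ?_)
    rcases hwalls n with ⟨hk', _⟩ | ⟨_, hl'⟩
    · exact hk' ▸ (hfk (n + 1)).symm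
    · exact hl' ▸ (hfl (n + 1)).symm

include hs hkl hfk hfl hrec hordG hc hℓ hin htr hiso hmove hb hwalls hskew in
/-- **L6/L7 · ENTRY INTO THE REGIME:** from some stage on, `α_n > 0` and `ε_n > 0` forever. [new] -/
theorem regime : ∃ N₁, ∀ n, N₁ ≤ n →
    0 < (lexMin (framePts s G ℓ f k l j n)).1 ∧ 0 < minSnd (framePts s G ℓ f k l j n) := by
  have hstep := step_laws hs hkl hfk hfl hrec hordG hc hℓ hin htr hiso hmove hb hwalls
  have hne := framePts_nonempty hkl hfk hfl hiso hwalls (s := s) (G := G) (ℓ := ℓ) (j := j)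
  -- a `Ψ`-move `n₀`; afterwards `α > 0` forever
  obtain ⟨n₀, -, hΨ₀⟩ := psi_moves_io hkl hfk hfl hmove hb hwalls hskew (j := j) 0
  have hα : ∀ m, n₀ + 1 ≤ m → 0 < (lexMin (framePts s G ℓ f k l j m)).1 := by
    intro m hm
    induction m, hm using Nat.le_induction with
    | base =>
      have hmem := lexMin_mem (hne (n₀ + 1))
      exact ((hstep n₀).1 _ hmem).2 hΨ₀
    | succ m hm ih =>
      rcases slots_spec hkl hwalls (j := j) m with ⟨hu, hv⟩ | ⟨hu, hv⟩
      · -- `Φ`-move at `m` with `α_m > 0`: exact transport, `α_{m+1} = α_m`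
        have hex := ((hstep m).2 ⟨fun _ => ih, fun h => absurd h (by rw [hu]; exact hkl m)⟩).1 hv
        rw [hex, phi_fst]; exact ih
      · have hmem := lexMin_mem (hne (m + 1))
        exact ((hstep m).1 _ hmem).2 hu
  -- a `Φ`-move `n₁ > n₀`; afterwards `ε > 0` forever
  obtain ⟨n₁, hn₁, hΦ₁⟩ := phi_moves_io hkl hfk hfl hmove hb hwalls hskew (j := j) (n₀ + 1)
  have hε : ∀ m, n₁ + 1 ≤ m → 0 < minSnd (framePts s G ℓ f k l j m) := by
    intro m hm
    induction m, hm using Nat.le_induction with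
    | base => exact lt_minSnd (hne (n₁ + 1)) fun x hx => ((hstep n₁).1 x hx).1 hΦ₁
    | succ m hm ih =>
      rcases slots_spec hkl hwalls (j := j) m with ⟨hu, hv⟩ | ⟨hu, hv⟩
      · exact lt_minSnd (hne (m + 1)) fun x hx => ((hstep m).1 x hx).1 hv
      · -- `Ψ`-move at `m` with `ε_m > 0`: exact transport, `ε_{m+1} ≥ ε_m`
        have hex := ((hstep m).2 ⟨fun _ => hα m (by omega), fun _ => ih⟩).2 hu
        exact lt_of_lt_of_le ih hex.2
  exact ⟨n₁ + 1, fun n hn => ⟨hα n (by omega), hε n hn⟩⟩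

include hs hkl hfk hfl hrec hordG hc hℓ hin htr hiso hmove hb hwalls in
/-- **L7 · THE β-DESCENT:** in the regime `β` never increases and drops by at least `1/s` at every `Φ`-move. [new] -/
theorem beta_step {N₁ : ℕ} (hN : ∀ n, N₁ ≤ n →
      0 < (lexMin (framePts s G ℓ f k l j n)).1 ∧ 0 < minSnd (framePts s G ℓ f k l j n)) (n : ℕ) (hn : N₁ ≤ n) :
    (lexMin (framePts s G ℓ f k l j (n + 1))).2 ≤ (lexMin (framePts s G ℓ f k l j n)).2 ∧
      ((slots (k 0) (l 0) l j n).2 = l n →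
        (lexMin (framePts s G ℓ f k l j (n + 1))).2 ≤ (lexMin (framePts s G ℓ f k l j n)).2 - 1 / (s : ℚ)) := by
  have hstep := (step_laws hs hkl hfk hfl hrec hordG hc hℓ hin htr hiso hmove hb hwalls n).2
    ⟨fun _ => (hN n hn).1, fun _ => (hN n hn).2⟩
  have hαle := alpha_le hkl hfk hfl hiso hwalls (s := s) (G := G) (ℓ := ℓ) (j := j) n
  have hs' : (0 : ℚ) < 1 / (s : ℚ) := by
    have : (0 : ℚ) < (s : ℚ) := by exact_mod_cast Nat.pos_of_ne_zero hs
    positivity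
  rcases slots_spec hkl hwalls (j := j) n with ⟨hu, hv⟩ | ⟨hu, hv⟩
  · have hex := hstep.1 hv
    rw [hex, phi_snd]
    exact ⟨by linarith, fun _ => by linarith⟩
  · have hex := (hstep.2 hu).1
    exact ⟨hex, fun h => absurd h (by rw [hv]; exact hkl n)⟩

-- writer g14: `hskew` moved from the `include` list into an explicit (last) binder — the gate's signature dedup read the bare
-- header `: False` as a twin of `Literature.…Baker1975.Setup.false_of_setup` (bounce p828949); type and argument order unchanged.
include hs hkl hfk hfl hrec hordG hc hℓ hin htr hiso hmove hb hwalls in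
/-- **THE ABSTRACT WALL-CHAIN THEOREM.**  There is no infinite chain of near companion moves of order `s ≥ 1` in which
every stage has an isolated singular point, every tangent form is transversal to the current free axis, both walls are
lost infinitely often, and the centre of each move lies on the new free axis — uniformly in the characteristic and in
`s` (the hypothesis `p ∣ s` of the wild cell is NOT used).
[cite: CossartJannsenSaito2020, §§10–12 (β-descent); Kollar2007, 2.59; new: char-free frame] -/
theorem wallChain_false (hskew : ∀ (i : Fin 3) (M : ℕ), ∃ n, M ≤ n ∧ (j n = i ∨ b n i ≠ 0)) : False := by
  obtain ⟨N₁, hN⟩ := regime hs hkl hfk hfl hrec hordG hc hℓ hin htr hiso hmove hb hwalls hskew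
  have hβ := beta_step hs hkl hfk hfl hrec hordG hc hℓ hin htr hiso hmove hb hwalls hN
  set β : ℕ → ℚ := fun n => (lexMin (framePts s G ℓ f k l j n)).2 with hβdef
  have hmono : ∀ m n, N₁ ≤ m → m ≤ n → β n ≤ β m := by
    intro m n hm hmn
    induction n, hmn using Nat.le_induction with
    | base => exact le_rfl
    | succ n hmn ih => exact le_trans ((hβ n (le_trans hm hmn)).1) ih
  have hcount : ∀ M : ℕ, ∃ n, N₁ ≤ n ∧ β n ≤ β N₁ - (M : ℚ) / (s : ℚ) := by
    intro M
    induction M with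
    | zero => exact ⟨N₁, le_rfl, by simp⟩
    | succ M ih =>
      obtain ⟨n, hn, hβn⟩ := ih
      obtain ⟨m, hm, hΦ⟩ := phi_moves_io hkl hfk hfl hmove hb hwalls hskew (j := j) n
      refine ⟨m + 1, by omega, ?_⟩
      have h1 := (hβ m (by omega)).2 hΦ
      have h2 := hmono n m hn hm
      have : ((M + 1 : ℕ) : ℚ) / (s : ℚ) = (M : ℚ) / (s : ℚ) + 1 / (s : ℚ) := by push_cast; ring
      rw [this]
      change (lexMin (framePts s G ℓ f k l j (m + 1))).2 ≤ _
      have h2' : (lexMin (framePts s G ℓ f k l j m)).2 ≤ (lexMin (framePts s G ℓ f k l j n)).2 := h2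
      have hβn' : (lexMin (framePts s G ℓ f k l j n)).2 ≤ (lexMin (framePts s G ℓ f k l j N₁)).2 - (M : ℚ) / (s : ℚ) := hβn
      linarith
  have hspos : (0 : ℚ) < (s : ℚ) := by exact_mod_cast Nat.pos_of_ne_zero hs
  obtain ⟨M, hM⟩ := exists_nat_gt (β N₁ * (s : ℚ))
  obtain ⟨n, hn, hβn⟩ := hcount M
  have hnonneg := beta_nonneg (s := s) (G := G) (ℓ := ℓ) (f := f) (k := k) (l := l) (j := j) n
    (framePts_nonempty hkl hfk hfl hiso hwalls n)
  have hlt : β N₁ - (M : ℚ) / (s : ℚ) < 0 := by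
    rw [sub_neg, lt_div_iff₀ hspos]; exact hM
  have : β n < 0 := lt_of_le_of_lt hβn hlt
  exact absurd hnonneg (not_le.mpr this)

end Descent

end Chain

end Summit.ResolutionOfSingularities.ResolutionOfSingularities.Theorems.WildDescent
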